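import Literature.AlgebraicGeometry.Frobenioids.CoAngularPreSteps
import Literature.AlgebraicGeometry.Frobenioids.BiratSquaresSchemaNegative
import HarnessLib

/-!
# Frobenioids I, Proposition 1.11 (vii) as the predicate `HasCoAngularSquares F ε` (FACT-LIST F-1006):
# the universal closure over bare pre-Frobenioid structures is REFUTABLE

Mochizuki, *The geometry of Frobenioids I: the general theory*, Kyushu J. Math. **62** (2008)
293–400, §1, Proposition 1.11 (vii), kurims text p. 37 l. 12: "Let `φ : A → B` be a co-angular
pre-step; `ε : C → B` a morphism. Then there exists a co-angular pre-step `γ : D → C` and a morphism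
`α : D → A` such that `ε ∘ γ = φ ∘ α`." [cite: MochizukiFrdI2008, Prop. 1.11(vii) p.37]

Negative knowledge recorded next to `CoAngularPreSteps.lean` (abc-iut-L1-t1; FACT-LIST row **F-1006**
`PreFrobenioid.HasCoAngularSquares`, class `preparatory`, kernel_closedness `parametrised`, label
«universal-closure REFUTED / schema; instance forms model-witnessed» carried so far WITHOUT a kernel
object for the refutation — R7 TYPE-audit abc-iut-w5-d199), PROOF-ONLY (no definitions, no instances,
no notation), abc-iut cell seat abc-iut-f-025.  Twin of `BiratSquaresSchemaNegative.lean` (F-0949,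
`HasBiratSquares` = the same square property quantified over `ε` as well).

`HasCoAngularSquares F ε` is Prop. 1.11 (vii) for a FIXED arrow `ε : X → B` of an arbitrary
pre-Frobenioid structure functor `F : C ⥤ F_Φ`.  Print proves it for every Frobenioid and every `ε`, and
so does the tree, in that generality: `PreFrobenioid.hasCoAngularSquares (hF : IsFrobenioid F) (ε) :
HasCoAngularSquares F ε` (abc-iut-L1-t1, with the four cases of the printed proof
`hasCoAngularSquares_of_isPullbackMorphism / _of_isIsometricPreStep / _of_isCoAngularPreStep /
_of_isFrobeniusType` and the restatement `exists_coAngular_square`).  Without the axioms of Def. 1.3 the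
closure is false, at the witness of F-0949: `C = WalkingCospan`, `F = cospan (𝟙 ⋆) (id, 1, 1) : C ⥤ F_{Φ_ℕ}`
over the one-morphism base, `ε := inl`, `φ := inr` (a co-angular pre-step,
`PreFrobenioid.isCoAngularPreStep_cospan_inr`): `left` receives only its identity and has no arrow to
`right`, so no square exists (`not_hasCoAngularSquares_cospan_inl`, `not_forall_hasCoAngularSquares`).

So the row is admissible ONLY under `IsFrobenioid F` (where it is a THEOREM of the tree) / at instances.
Elementary; nothing here bears on the disputed [IUTchIII] Cor. 3.12 or takes a side; refuting the
closure of OUR typing is not a statement about print.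
-/

namespace Literature.AlgebraicGeometry.Frobenioids

open CategoryTheory CategoryTheory.Limits Opposite

namespace PreFrobenioid

/-- **F-1006, an arrow WITHOUT co-angular squares:** in the cospan-shaped pre-Frobenioid structure over
`F_{Φ_ℕ}` the arrow `ε = inl : left → one` admits no square against the co-angular pre-step
`φ = inr : right → one`: the only arrow into `left` is its identity and there is no arrow `left → right`.
[cite: MochizukiFrdI2008, Prop. 1.11(vii) p.37] -/
theorem not_hasCoAngularSquares_cospan_inl :
    ¬ HasCoAngularSquares
      (cospan (𝟙 (ElemFrobenioid.of (constMonoidOn (Multiplicative ℕ)) (Discrete.mk PUnit.unit)))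
        (ElemFrobenioid.homMk
          (A := ElemFrobenioid.of (constMonoidOn (Multiplicative ℕ)) (Discrete.mk PUnit.unit))
          (B := ElemFrobenioid.of (constMonoidOn (Multiplicative ℕ)) (Discrete.mk PUnit.unit))
          (𝟙 _) (Multiplicative.ofAdd (1 : ℕ) : Multiplicative ℕ) 1))
      WalkingCospan.Hom.inl := by
  intro h
  obtain ⟨W, γ, α, -, -⟩ := h WalkingCospan.Hom.inr isCoAngularPreStep_cospan_inr
  cases γ with
  | id _ => cases α

end PreFrobenioid

/-! ### The fully quantified closure, refuted at the cospan-shaped structure -/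

/-- **FACT-LIST F-1006, universal closure REFUTED** (witness: `C = WalkingCospan`,
`F = cospan (𝟙 ⋆) (id, 1, 1) : C ⥤ F_{Φ_ℕ}`, `ε = inl`).  The consumed form — Prop. 1.11 (vii) for a
FROBENIOID — is the theorem `PreFrobenioid.hasCoAngularSquares` / `exists_coAngular_square` of the tree.
[cite: MochizukiFrdI2008, Prop. 1.11(vii) p.37] -/
theorem PreFrobenioid.not_forall_hasCoAngularSquares :
    ¬ ∀ (D : Type) [Category.{0} D] (Φ : Dᵒᵖ ⥤ CommMonCat.{0}) (C : Type) [Category.{0} C]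
        (F : C ⥤ ElemFrobenioid Φ) (X B : C) (ε : X ⟶ B),
        Literature.AlgebraicGeometry.Frobenioids.PreFrobenioid.HasCoAngularSquares F ε :=
  fun h => PreFrobenioid.not_hasCoAngularSquares_cospan_inl (h _ _ _ _ _ _ _)

end Literature.AlgebraicGeometry.Frobenioids
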